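import Mathlib
import HarnessLib

/-!
# Truncated Fock space shifts: no nc polynomial vanishes on all symmetric tuples

[cite: BlekhermanParriloThomas2012, Ch. 8 §8.2.1 Proposition 8.6, §8.2.7 Exercise 8.28,
§8.5.4 Exercise 8.96]

Blekherman–Parrilo–Thomas, *Semidefinite Optimization and Convex Algebraic Geometry*
(MOS–SIAM Series on Optimization 13, SIAM 2012), Chapter 8 (Helton–Klep–McCullough,
"Free convex algebraic geometry").

Proposition 8.6 (first assertion): a nonzero noncommutative polynomial `p ∈ ℝ⟨x⟩` in `g`
symmetric noncommuting variables does not vanish on all `g`-tuples of symmetric matrices of all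
sizes.  We formalise the proof laid out in Exercise 8.28 (truncated shifts on Fock space):

* the words of length `≤ k` index an orthonormal basis of `ℝ⟨x⟩_k` (`FockIdx g k`, of
  cardinality `σ(k) = Σ_{j ≤ k} g^j`, (8.14), `card_fockIdx`), the empty word `∅` being the
  *vacuum* (`vac`);
* `crea j` is the truncated shift `T_j = V^⊤ S_j V`: `T_j v = x_j v` on words `v` of length
  `≤ k - 1` and `T_j v = 0` on words of length `k` (Exercise 8.28 (a), `crea_mulVec_single`,
  `crea_mulVec_single_of_length_eq`); its transpose is the backward shift deleting a leading
  letter `x_j` (Exercise 8.28 (b), `crea_transpose_mulVec_single_cons`,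
  `crea_transpose_mulVec_single_of_ne`);
* `fockY j = T_j + T_jᵀ` is symmetric, and for a nonzero `p` of degree `≤ k` one has
  `p(Y) ∅ ≠ 0` (Exercise 8.28 (c), `eval_fockY_mulVec_vac_ne_zero`): the component of `p(Y)∅`
  along a word `w` of maximal length in the support of `p` is exactly the coefficient of `w`;
* consequently, if `p(X) = 0` for every `n` and every `X ∈ (𝕊ⁿ)ᵍ`, then `p = 0`
  (Exercise 8.28 (d) = Proposition 8.6 (first assertion),
  `eq_zero_of_forall_isSymm_eval_eq_zero`), and a linear relation among
  `p₁(Y)∅, …, p_ℓ(Y)∅` is already a linear relation among `p₁, …, p_ℓ` (Exercise 8.96, the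
  Fock-space strengthening of Corollary 8.86 for polynomials, `sum_smul_eq_zero_of_fockY`).

Conventions: `ℝ⟨x⟩ = FreeAlgebra ℝ (Fin g)`, evaluation at a tuple `X` is `FreeAlgebra.lift ℝ X`,
words are `FreeMonoid (Fin g)` (coefficients read through
`FreeAlgebra.equivMonoidAlgebraFreeMonoid`), and a word `[j₁, …, j_m]` stands for the monomial
`x_{j₁} ⋯ x_{j_m}`, so that left multiplication by `x_j` is `List.cons j`.
-/

namespace Literature.Algebra.Polynomial.FockSpaceShift

open Matrix

variable {g k : ℕ}

/-- The words of length at most `k` in `g` letters: an (orthonormal) basis of `ℝ⟨x⟩_k`, the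
index set of the truncated Fock space.
[cite: BlekhermanParriloThomas2012, Ch. 8 §8.2.7 Exercise 8.28] -/
abbrev FockIdx (g k : ℕ) : Type := {w : List (Fin g) // w.length ≤ k}

/-- There are only finitely many words of length `≤ k` (their number is `σ(k)` of (8.14)).
[cite: BlekhermanParriloThomas2012, Ch. 8 §8.2.7 Exercise 8.28 (8.14)] -/
instance : Finite (FockIdx g k) := (List.finite_length_le (Fin g) k).to_subtype

/-- The truncated Fock space `ℝ⟨x⟩_k` is finite dimensional, of dimension `σ(k)`.
[cite: BlekhermanParriloThomas2012, Ch. 8 §8.2.7 Exercise 8.28 (8.14)] -/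
noncomputable instance : Fintype (FockIdx g k) := Fintype.ofFinite _

/-- The length of a word of `ℝ⟨x⟩_k`, an element of `{0, …, k}` (the word-length grading).
[cite: BlekhermanParriloThomas2012, Ch. 8 §8.2.7 Exercise 8.28 (8.14)] -/
def wordLen (w : FockIdx g k) : Fin (k + 1) := ⟨w.1.length, Nat.lt_succ_of_le w.2⟩

/-- The words of length exactly `j ≤ k` are the `j`-tuples of letters, `g^j` of them.
[cite: BlekhermanParriloThomas2012, Ch. 8 §8.2.7 Exercise 8.28 (8.14)] -/
def fiberEquivVector (j : Fin (k + 1)) :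
    {w : FockIdx g k // wordLen w = j} ≃ List.Vector (Fin g) j where
  toFun w := ⟨w.1.1, congrArg Fin.val w.2⟩
  invFun v := ⟨⟨v.1, by have h₁ := v.2; have h₂ := j.2; omega⟩, Fin.ext v.2⟩
  left_inv _ := rfl
  right_inv _ := rfl

/-- (8.14): `dim ℝ⟨x⟩_k = σ(k) = Σ_{j=0}^{k} g^j`.
[cite: BlekhermanParriloThomas2012, Ch. 8 §8.2.7 Exercise 8.28 (8.14)] -/
theorem card_fockIdx (g k : ℕ) :
    Fintype.card (FockIdx g k) = ∑ j ∈ Finset.range (k + 1), g ^ j := by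
  rw [← Fintype.card_congr (Equiv.sigmaFiberEquiv (wordLen (g := g) (k := k))),
    Fintype.card_sigma, ← Fin.sum_univ_eq_sum_range (fun j => g ^ j) (k + 1)]
  exact Finset.sum_congr rfl fun j _ => by
    rw [Fintype.card_congr (fiberEquivVector j), card_vector, Fintype.card_fin]

/-- The vacuum: the empty word `∅`.
[cite: BlekhermanParriloThomas2012, Ch. 8 §8.2.7 Exercise 8.28 (c)] -/
def vac : FockIdx g k := ⟨[], by simp⟩

/-- The vacuum is the empty word.
[cite: BlekhermanParriloThomas2012, Ch. 8 §8.2.7 Exercise 8.28 (c)] -/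
@[simp] theorem vac_val : (vac : FockIdx g k).1 = [] := rfl

/-- The truncated shift `T_j = V^⊤ S_j V` on `ℝ⟨x⟩_k` as a matrix in the word basis:
`(T_j)_{w', w} = 1` iff `w' = x_j w`.
[cite: BlekhermanParriloThomas2012, Ch. 8 §8.2.7 Exercise 8.28] -/
noncomputable def crea (j : Fin g) : Matrix (FockIdx g k) (FockIdx g k) ℝ :=
  fun w' w => if w'.1 = j :: w.1 then 1 else 0

/-- Matrix entries of the truncated shift `T_j`.
[cite: BlekhermanParriloThomas2012, Ch. 8 §8.2.7 Exercise 8.28 (a)] -/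
theorem crea_apply (j : Fin g) (w' w : FockIdx g k) :
    crea j w' w = if w'.1 = j :: w.1 then 1 else 0 := rfl

/-- The symmetric tuple `Y_j = T_j + T_jᵀ` of Exercise 8.28 (c).
[cite: BlekhermanParriloThomas2012, Ch. 8 §8.2.7 Exercise 8.28 (c)] -/
noncomputable def fockY (j : Fin g) : Matrix (FockIdx g k) (FockIdx g k) ℝ :=
  crea j + (crea j)ᵀ

/-- Each `Y_j` is symmetric.
[cite: BlekhermanParriloThomas2012, Ch. 8 §8.2.7 Exercise 8.28 (c)] -/
theorem isSymm_fockY (j : Fin g) :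
    (fockY j : Matrix (FockIdx g k) (FockIdx g k) ℝ).IsSymm := by
  unfold fockY Matrix.IsSymm
  rw [transpose_add, transpose_transpose, add_comm]

/-! ## Exercise 8.28 (a), (b): the shift and its transpose on basis words -/

/-- [folklore] `M e_w` is the `w`-th column of `M`. -/
private theorem mulVec_single_one_apply {ι : Type*} [Fintype ι] [DecidableEq ι]
    (M : Matrix ι ι ℝ) (w w' : ι) : (M *ᵥ Pi.single w 1) w' = M w' w := by
  rw [Matrix.mulVec_single_one]; rfl

/-- Exercise 8.28 (a): `T_j v = x_j v` for a word `v` of length at most `k - 1`.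
[cite: BlekhermanParriloThomas2012, Ch. 8 §8.2.7 Exercise 8.28 (a)] -/
theorem crea_mulVec_single (j : Fin g) (w : FockIdx g k) (h : (j :: w.1).length ≤ k) :
    crea j *ᵥ Pi.single w 1 = Pi.single (⟨j :: w.1, h⟩ : FockIdx g k) 1 := by
  ext w'
  rw [mulVec_single_one_apply, crea_apply, Pi.single_apply]
  exact if_congr (Subtype.ext_iff (a1 := w') (a2 := ⟨j :: w.1, h⟩)).symm rfl rfl

/-- Exercise 8.28 (a): `T_j v = 0` for a word `v` of length exactly `k`.
[cite: BlekhermanParriloThomas2012, Ch. 8 §8.2.7 Exercise 8.28 (a)] -/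
theorem crea_mulVec_single_of_length_eq (j : Fin g) (w : FockIdx g k) (h : w.1.length = k) :
    crea j *ᵥ Pi.single w 1 = 0 := by
  ext w'
  rw [mulVec_single_one_apply, crea_apply, Pi.zero_apply, if_neg]
  intro h'
  have := w'.2
  rw [h', List.length_cons, h] at this
  omega

/-- Exercise 8.28 (b): `T_jᵀ` is the backward shift, `T_jᵀ (x_j v) = v`.
[cite: BlekhermanParriloThomas2012, Ch. 8 §8.2.7 Exercise 8.28 (b)] -/
theorem crea_transpose_mulVec_single_cons (j : Fin g) (w : FockIdx g k)
    (h : (j :: w.1).length ≤ k) :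
    (crea j)ᵀ *ᵥ Pi.single (⟨j :: w.1, h⟩ : FockIdx g k) 1 = Pi.single w 1 := by
  ext w'
  rw [mulVec_single_one_apply, transpose_apply, crea_apply, Pi.single_apply]
  refine if_congr ⟨fun h' => ?_, fun h' => ?_⟩ rfl rfl
  · have h'' : j :: w.1 = j :: w'.1 := h'
    exact Subtype.ext (List.cons.inj h'').2.symm
  · rw [h']

/-- Exercise 8.28 (b): `T_jᵀ v = 0` for a word `v` not starting with the letter `x_j`
(in particular for `v = ∅`).
[cite: BlekhermanParriloThomas2012, Ch. 8 §8.2.7 Exercise 8.28 (b)] -/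
theorem crea_transpose_mulVec_single_of_ne (j : Fin g) (w : FockIdx g k)
    (h : ∀ t : List (Fin g), w.1 ≠ j :: t) : (crea j)ᵀ *ᵥ Pi.single w 1 = 0 := by
  ext w'
  rw [mulVec_single_one_apply, transpose_apply, crea_apply, Pi.zero_apply, if_neg (h w'.1)]

/-! ## Exercise 8.28 (c): `p(Y) ∅ ≠ 0` -/

/-- A vector of the truncated Fock space is *supported below length `m`* if its components
along all words of length `≥ m` vanish.
[cite: BlekhermanParriloThomas2012, Ch. 8 §8.2.7 Exercise 8.28 (c)] -/
def SuppBelow (m : ℕ) (f : FockIdx g k → ℝ) : Prop :=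
  ∀ w : FockIdx g k, m ≤ w.1.length → f w = 0

/-- [folklore] -/
private theorem SuppBelow.zero (m : ℕ) : SuppBelow m (0 : FockIdx g k → ℝ) := fun _ _ => rfl

/-- [folklore] -/
private theorem SuppBelow.add {m : ℕ} {f₁ f₂ : FockIdx g k → ℝ} (h₁ : SuppBelow m f₁)
    (h₂ : SuppBelow m f₂) : SuppBelow m (f₁ + f₂) := fun w hw => by
  rw [Pi.add_apply, h₁ w hw, h₂ w hw, add_zero]

/-- [folklore] -/
private theorem SuppBelow.smul {m : ℕ} {f : FockIdx g k → ℝ} (c : ℝ) (h : SuppBelow m f) :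
    SuppBelow m (c • f) := fun w hw => by
  rw [Pi.smul_apply, h w hw, smul_zero]

/-- [folklore] -/
private theorem SuppBelow.mono {m m' : ℕ} (hm : m ≤ m') {f : FockIdx g k → ℝ} (h : SuppBelow m f) :
    SuppBelow m' f := fun w hw => h w (hm.trans hw)

/-- [folklore] The basis vector of a word of length `< m` is supported below length `m`. -/
private theorem suppBelow_single {m : ℕ} (w : FockIdx g k) (hw : w.1.length < m) :
    SuppBelow m (Pi.single w (1 : ℝ)) := fun w' hw' => by
  rw [Pi.single_apply, if_neg]
  rintro rfl
  omega

/-- The shift raises the length filtration by one: if `f` is supported below length `m` then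
`T_j f` is supported below length `m + 1`.
[cite: BlekhermanParriloThomas2012, Ch. 8 §8.2.7 Exercise 8.28 (a)] -/
theorem SuppBelow.crea_mulVec {m : ℕ} (j : Fin g) {f : FockIdx g k → ℝ} (h : SuppBelow m f) :
    SuppBelow (m + 1) (crea j *ᵥ f) := fun w' hw' => by
  refine Finset.sum_eq_zero fun w _ => ?_
  show crea j w' w * f w = 0
  rw [crea_apply]
  split_ifs with h'
  · rw [h w (by have := congrArg List.length h'; rw [List.length_cons] at this; omega), mul_zero]
  · rw [zero_mul]

/-- The backward shift does not raise the length filtration.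
[cite: BlekhermanParriloThomas2012, Ch. 8 §8.2.7 Exercise 8.28 (b)] -/
theorem SuppBelow.crea_transpose_mulVec {m : ℕ} (j : Fin g) {f : FockIdx g k → ℝ}
    (h : SuppBelow m f) : SuppBelow m ((crea j)ᵀ *ᵥ f) := fun w' hw' => by
  refine Finset.sum_eq_zero fun w _ => ?_
  show crea j w w' * f w = 0
  rw [crea_apply]
  split_ifs with h'
  · rw [h w (by rw [h', List.length_cons]; omega), mul_zero]
  · rw [zero_mul]

/-- `Y_j = T_j + T_jᵀ` raises the length filtration by at most one.
[cite: BlekhermanParriloThomas2012, Ch. 8 §8.2.7 Exercise 8.28 (c)] -/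
theorem SuppBelow.fockY_mulVec {m : ℕ} (j : Fin g) {f : FockIdx g k → ℝ} (h : SuppBelow m f) :
    SuppBelow (m + 1) (fockY j *ᵥ f) := by
  rw [fockY, add_mulVec]
  exact (h.crea_mulVec j).add ((h.crea_transpose_mulVec j).mono (Nat.le_succ m))

/-- The matrix monomial `Y^u = Y_{u₁} ⋯ Y_{u_m}` of a word `u = [u₁, …, u_m]`.
[cite: BlekhermanParriloThomas2012, Ch. 8 §8.2.7 Exercise 8.28 (c)] -/
noncomputable def wordY (u : List (Fin g)) : Matrix (FockIdx g k) (FockIdx g k) ℝ :=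
  (u.map fockY).prod

/-- The empty word acts as the identity.
[cite: BlekhermanParriloThomas2012, Ch. 8 §8.2.1 (8.4)] -/
@[simp] theorem wordY_nil : (wordY [] : Matrix (FockIdx g k) (FockIdx g k) ℝ) = 1 := by
  simp [wordY]

/-- `Y^{x_j u} = Y_j Y^u`.
[cite: BlekhermanParriloThomas2012, Ch. 8 §8.2.1 (8.4)] -/
@[simp] theorem wordY_cons (j : Fin g) (u : List (Fin g)) :
    (wordY (j :: u) : Matrix (FockIdx g k) (FockIdx g k) ℝ) = fockY j * wordY u := by
  simp [wordY]

/-- The key computation of Exercise 8.28 (c): for a word `u` of length `≤ k`,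
`Y^u ∅ = u + (words of length < |u|)`.
[cite: BlekhermanParriloThomas2012, Ch. 8 §8.2.7 Exercise 8.28 (c)] -/
theorem wordY_mulVec_vac (u : List (Fin g)) (hu : u.length ≤ k) :
    SuppBelow u.length
      (wordY u *ᵥ Pi.single (vac : FockIdx g k) 1 - Pi.single (⟨u, hu⟩ : FockIdx g k) 1) := by
  induction u with
  | nil =>
    rw [wordY_nil, Matrix.one_mulVec]
    exact fun w _ => by rw [Pi.sub_apply, sub_eq_zero]; rfl
  | cons j u ih =>
    have hu' : u.length ≤ k := (Nat.le_succ _).trans (by simpa using hu)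
    have key : wordY (j :: u) *ᵥ Pi.single (vac : FockIdx g k) 1 -
        Pi.single (⟨j :: u, hu⟩ : FockIdx g k) 1 =
        fockY j *ᵥ (wordY u *ᵥ Pi.single (vac : FockIdx g k) 1 -
          Pi.single (⟨u, hu'⟩ : FockIdx g k) 1) +
        (crea j)ᵀ *ᵥ Pi.single (⟨u, hu'⟩ : FockIdx g k) 1 := by
      rw [wordY_cons, ← mulVec_mulVec, mulVec_sub, fockY, add_mulVec _ _ (Pi.single _ _),
        crea_mulVec_single j ⟨u, hu'⟩ hu, ← fockY]
      abel
    rw [key]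
    refine ((ih hu').fockY_mulVec j).add ?_
    simpa using (suppBelow_single (m := u.length + 1) (⟨u, hu'⟩ : FockIdx g k)
      (Nat.lt_succ_self _)).crea_transpose_mulVec j

/-- Consequence: the component of `Y^u ∅` along a word `w` of length `≥ |u|` is `[u = w]`.
[cite: BlekhermanParriloThomas2012, Ch. 8 §8.2.7 Exercise 8.28 (c)] -/
theorem wordY_mulVec_vac_apply (u : List (Fin g)) (hu : u.length ≤ k) (w : FockIdx g k)
    (hw : u.length ≤ w.1.length) :
    (wordY u *ᵥ Pi.single (vac : FockIdx g k) (1 : ℝ)) w = if u = w.1 then 1 else 0 := by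
  have h := wordY_mulVec_vac u hu w hw
  rw [Pi.sub_apply, sub_eq_zero] at h
  rw [h, Pi.single_apply]
  exact if_congr ⟨fun h' => by rw [h'], fun h' => Subtype.ext h'.symm⟩ rfl rfl

/-- The coefficient functional: `coeff p u` is the coefficient of the word `u` in `p ∈ ℝ⟨x⟩`,
read through `ℝ⟨x⟩ ≃ ℝ[FreeMonoid (Fin g)]`.
[cite: BlekhermanParriloThomas2012, Ch. 8 §8.2.1 (8.3)] -/
noncomputable def coeff (p : FreeAlgebra ℝ (Fin g)) : FreeMonoid (Fin g) →₀ ℝ :=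
  (FreeAlgebra.equivMonoidAlgebraFreeMonoid (R := ℝ) (X := Fin g) p).coeff

/-- A polynomial vanishes iff all its coefficients do.
[cite: BlekhermanParriloThomas2012, Ch. 8 §8.2.1 (8.3)] -/
theorem coeff_eq_zero_iff (p : FreeAlgebra ℝ (Fin g)) : coeff p = 0 ↔ p = 0 := by
  rw [coeff, MonoidAlgebra.coeff_eq_zero]
  exact map_eq_zero_iff _
    (FreeAlgebra.equivMonoidAlgebraFreeMonoid (R := ℝ) (X := Fin g)).injective

/-- Evaluation of `p` at a tuple `Y` in any algebra, expanded over the words of `p`: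
`p(Y) = Σ_u p_u · Y^u`.
[cite: BlekhermanParriloThomas2012, Ch. 8 §8.2.1 (8.4)] -/
theorem lift_eq_sum_coeff {A : Type*} [Semiring A] [Algebra ℝ A] (Y : Fin g → A)
    (p : FreeAlgebra ℝ (Fin g)) :
    FreeAlgebra.lift ℝ Y p =
      (coeff p).sum fun u r => r • ((FreeMonoid.toList u).map Y).prod := by
  have hcomp : FreeAlgebra.lift ℝ Y =
      (MonoidAlgebra.lift ℝ A (FreeMonoid (Fin g)) (FreeMonoid.lift Y)).comp
        (FreeAlgebra.equivMonoidAlgebraFreeMonoid (R := ℝ) (X := Fin g)).toAlgHom := by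
    ext j
    simp [FreeAlgebra.equivMonoidAlgebraFreeMonoid]
  have happ := congrArg (fun φ : FreeAlgebra ℝ (Fin g) →ₐ[ℝ] A => φ p) hcomp
  simp only [AlgHom.comp_apply] at happ
  rw [happ]
  show MonoidAlgebra.lift ℝ A (FreeMonoid (Fin g)) (FreeMonoid.lift Y)
      (FreeAlgebra.equivMonoidAlgebraFreeMonoid (R := ℝ) (X := Fin g) p) = _
  rw [MonoidAlgebra.lift_apply]
  simp only [FreeMonoid.lift_apply]
  rfl

/-- Exercise 8.28 (c), quantitative form: for every `k` at least the degree of `p`, the component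
of `p(Y) ∅` along a word `w` of maximal length in the support of `p` is the coefficient `p_w`.
[cite: BlekhermanParriloThomas2012, Ch. 8 §8.2.7 Exercise 8.28 (c)] -/
theorem eval_fockY_mulVec_vac_apply (p : FreeAlgebra ℝ (Fin g))
    (hk : ∀ u ∈ (coeff p).support, (FreeMonoid.toList u).length ≤ k) (w : FockIdx g k)
    (hw : ∀ u ∈ (coeff p).support, (FreeMonoid.toList u).length ≤ w.1.length) :
    (FreeAlgebra.lift ℝ (fockY (g := g) (k := k)) p *ᵥ Pi.single vac 1) w =
      coeff p (FreeMonoid.ofList w.1) := by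
  classical
  rw [lift_eq_sum_coeff, Finsupp.sum, Matrix.sum_mulVec, Finset.sum_apply]
  have : ∀ u ∈ (coeff p).support,
      ((coeff p u • ((FreeMonoid.toList u).map (fockY (g := g) (k := k))).prod) *ᵥ
          Pi.single (vac : FockIdx g k) (1 : ℝ)) w =
        if u = FreeMonoid.ofList w.1 then coeff p u else 0 := by
    intro u hu
    rw [Matrix.smul_mulVec, Pi.smul_apply, ← wordY,
      wordY_mulVec_vac_apply _ (hk u hu) w (hw u hu), smul_eq_mul, mul_ite, mul_one, mul_zero]
    refine if_congr ⟨fun h => ?_, fun h => ?_⟩ rfl rfl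
    · rw [← h]; rfl
    · rw [h]; rfl
  rw [Finset.sum_congr rfl this, Finset.sum_ite_eq']
  split_ifs with h
  · rfl
  · exact (Finsupp.notMem_support_iff.1 h).symm

/-- Exercise 8.28 (c): if `p ≠ 0` has degree at most `k`, then `p(Y) ∅ ≠ 0` for the symmetric
tuple `Y = (T_j + T_jᵀ)_j` of `σ(k) × σ(k)` matrices.
[cite: BlekhermanParriloThomas2012, Ch. 8 §8.2.7 Exercise 8.28 (c)] -/
theorem eval_fockY_mulVec_vac_ne_zero (p : FreeAlgebra ℝ (Fin g)) (hp : p ≠ 0)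
    (hk : ∀ u ∈ (coeff p).support, (FreeMonoid.toList u).length ≤ k) :
    FreeAlgebra.lift ℝ (fockY (g := g) (k := k)) p *ᵥ Pi.single vac 1 ≠ 0 := by
  have hne : (coeff p).support.Nonempty := by
    rw [Finsupp.support_nonempty_iff, Ne, coeff_eq_zero_iff]
    exact hp
  obtain ⟨u₀, hu₀, hmax⟩ :=
    (coeff p).support.exists_max_image (fun u => (FreeMonoid.toList u).length) hne
  intro h
  have h₀ := eval_fockY_mulVec_vac_apply p hk ⟨FreeMonoid.toList u₀, hk u₀ hu₀⟩
    (fun u hu => hmax u hu)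
  rw [h, Pi.zero_apply] at h₀
  exact (Finsupp.mem_support_iff.1 hu₀) (by simpa using h₀.symm)

/-- `coeff` is additive and homogeneous: the coefficients of a linear combination.
[cite: BlekhermanParriloThomas2012, Ch. 8 §8.2.1 (8.3)] -/
theorem coeff_sum_smul {ℓ : ℕ} (c : Fin ℓ → ℝ) (f : Fin ℓ → FreeAlgebra ℝ (Fin g)) :
    coeff (∑ i, c i • f i) = ∑ i, c i • coeff (f i) := by
  simp only [coeff, map_sum, map_smul, MonoidAlgebra.coeff_sum, MonoidAlgebra.coeff_smul]

/-- Exercise 8.96 (the Fock-space strengthening of Corollary 8.86 for polynomials): if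
`p₁, …, p_ℓ ∈ ℝ⟨x⟩_k` and the vectors `p₁(Y)∅, …, p_ℓ(Y)∅ ∈ ℝ^{σ(k)}` satisfy a linear relation
at the single symmetric tuple `Y` of `σ(k) × σ(k)` matrices and the single vector `∅`, then
`p₁, …, p_ℓ` satisfy the same linear relation; in particular linear dependence of
`{p₁(X)v, …, p_ℓ(X)v}` for all `(X, v) ∈ (𝕊^{σ×σ})ᵍ × ℝ^σ` forces linear dependence of
`{p₁, …, p_ℓ}`.
[cite: BlekhermanParriloThomas2012, Ch. 8 §8.5.4 Exercise 8.96 (with Exercise 8.28 (c))] -/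
theorem sum_smul_eq_zero_of_fockY {ℓ : ℕ} (f : Fin ℓ → FreeAlgebra ℝ (Fin g))
    (hk : ∀ i, ∀ u ∈ (coeff (f i)).support, (FreeMonoid.toList u).length ≤ k) (c : Fin ℓ → ℝ)
    (hc : ∑ i, c i • (FreeAlgebra.lift ℝ (fockY (g := g) (k := k)) (f i) *ᵥ Pi.single vac 1)
      = 0) :
    ∑ i, c i • f i = 0 := by
  classical
  by_contra hne
  refine eval_fockY_mulVec_vac_ne_zero (k := k) (∑ i, c i • f i) hne (fun u hu => ?_) ?_
  · rw [coeff_sum_smul] at hu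
    obtain ⟨i, _, hi⟩ := Finset.mem_biUnion.1 (Finsupp.support_finsetSum hu)
    exact hk i u (Finsupp.support_smul hi)
  · rw [map_sum, Matrix.sum_mulVec, ← hc]
    exact Finset.sum_congr rfl fun i _ => by rw [map_smul, Matrix.smul_mulVec]

/-- Exercise 8.96, dependence form: pointwise linear dependence of `p₁(X)v, …, p_ℓ(X)v` at the
Fock point `(Y, ∅)` of size `σ(k)`, `k ≥ max deg pᵢ`, already forces linear dependence of
`p₁, …, p_ℓ` in `ℝ⟨x⟩`.
[cite: BlekhermanParriloThomas2012, Ch. 8 §8.5.4 Exercise 8.96 (with Exercise 8.28 (c))] -/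
theorem exists_dependence_of_fockY {ℓ : ℕ} (f : Fin ℓ → FreeAlgebra ℝ (Fin g))
    (hk : ∀ i, ∀ u ∈ (coeff (f i)).support, (FreeMonoid.toList u).length ≤ k)
    (h : ∃ c : Fin ℓ → ℝ, c ≠ 0 ∧
      ∑ i, c i • (FreeAlgebra.lift ℝ (fockY (g := g) (k := k)) (f i) *ᵥ Pi.single vac 1) = 0) :
    ∃ c : Fin ℓ → ℝ, c ≠ 0 ∧ ∑ i, c i • f i = 0 := by
  obtain ⟨c, hc0, hc⟩ := h
  exact ⟨c, hc0, sum_smul_eq_zero_of_fockY f hk c hc⟩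

/-! ## Exercise 8.28 (d) = Proposition 8.6: no polynomial identities for symmetric tuples -/

/-- [folklore] Evaluation commutes with a simultaneous re-indexing of the matrix tuple. -/
private theorem lift_reindex {ι : Type*} [Fintype ι] [DecidableEq ι] {n : ℕ} (e : ι ≃ Fin n)
    (Y : Fin g → Matrix ι ι ℝ) (p : FreeAlgebra ℝ (Fin g)) :
    FreeAlgebra.lift ℝ (fun j => reindex e e (Y j)) p =
      reindex e e (FreeAlgebra.lift ℝ Y p) := by
  have hcomp : FreeAlgebra.lift ℝ (fun j => reindex e e (Y j)) =
      (reindexAlgEquiv ℝ ℝ e).toAlgHom.comp (FreeAlgebra.lift ℝ Y) := by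
    ext j
    simp
  rw [hcomp]
  simp

/-- If `p ≠ 0` then `p(X) ≠ 0` for some `n` and some symmetric tuple `X ∈ (𝕊ⁿ)ᵍ`; one may take
`n = σ(k)` for any `k ≥ deg p` and `X` the re-indexed Fock tuple `Y`.
[cite: BlekhermanParriloThomas2012, Ch. 8 §8.2.1 Proposition 8.6, §8.2.7 Exercise 8.28 (d)] -/
theorem exists_isSymm_eval_ne_zero (p : FreeAlgebra ℝ (Fin g)) (hp : p ≠ 0) :
    ∃ (n : ℕ) (X : Fin g → Matrix (Fin n) (Fin n) ℝ),
      (∀ j, (X j).IsSymm) ∧ FreeAlgebra.lift ℝ X p ≠ 0 := by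
  classical
  set k := (coeff p).support.sup fun u => (FreeMonoid.toList u).length with hk
  have hk' : ∀ u ∈ (coeff p).support, (FreeMonoid.toList u).length ≤ k :=
    fun u hu => Finset.le_sup (f := fun u => (FreeMonoid.toList u).length) hu
  let e := Fintype.equivFin (FockIdx g k)
  refine ⟨Fintype.card (FockIdx g k), fun j => reindex e e (fockY j), fun j => ?_, fun h => ?_⟩
  · show (reindex e e (fockY j))ᵀ = reindex e e (fockY j)
    rw [transpose_reindex, (isSymm_fockY j).eq]
  · rw [lift_reindex] at h
    have h' : FreeAlgebra.lift ℝ (fockY (g := g) (k := k)) p = 0 :=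
      (reindex e e).injective (by rw [h]; simp)
    exact eval_fockY_mulVec_vac_ne_zero p hp hk' (by rw [h', zero_mulVec])

/-- Proposition 8.6 (first assertion) / Exercise 8.28 (d): a noncommutative polynomial which
vanishes on all tuples of symmetric matrices of all sizes is the zero polynomial — there are no
polynomial identities valid in all dimensions.
[cite: BlekhermanParriloThomas2012, Ch. 8 §8.2.1 Proposition 8.6, §8.2.7 Exercise 8.28 (d)] -/
theorem eq_zero_of_forall_isSymm_eval_eq_zero (p : FreeAlgebra ℝ (Fin g))
    (h : ∀ (n : ℕ) (X : Fin g → Matrix (Fin n) (Fin n) ℝ), (∀ j, (X j).IsSymm) →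
      FreeAlgebra.lift ℝ X p = 0) : p = 0 := by
  by_contra hp
  obtain ⟨n, X, hX, hne⟩ := exists_isSymm_eval_ne_zero p hp
  exact hne (h n X hX)

/-- Equivalently: two noncommutative polynomials taking the same value at every symmetric tuple of
every size are equal (so `p ↦ (X ↦ p(X))` is injective, as used implicitly throughout §8.2).
[cite: BlekhermanParriloThomas2012, Ch. 8 §8.2.1 Proposition 8.6] -/
theorem eq_of_forall_isSymm_eval_eq (p q : FreeAlgebra ℝ (Fin g))
    (h : ∀ (n : ℕ) (X : Fin g → Matrix (Fin n) (Fin n) ℝ), (∀ j, (X j).IsSymm) →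
      FreeAlgebra.lift ℝ X p = FreeAlgebra.lift ℝ X q) : p = q := by
  rw [← sub_eq_zero]
  exact eq_zero_of_forall_isSymm_eval_eq_zero _ fun n X hX => by rw [map_sub, h n X hX, sub_self]

end Literature.Algebra.Polynomial.FockSpaceShift
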